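import Summits.SmoothPoincare4.SmoothPoincare4.Theses.SymplecticOrigami
import Literature.Topology.FourManifolds.InverseFunctionTheorem

/-!
# Stub `stub_pinch_pieceHomeomorph` of line `pair-rigidity-endgame`
# (crux `SymplecticOrigami.OrigamiRung`)

Sub-goal of the lead's stub `stub_pinch`: the blow-down map `β : M → N` carries the open piece
`V` of the fold injectively onto the complement `Bᶜ` of the collapsed surface, smoothly and
with bijective differential; we package this as a homeomorphism of subtypes `↥V ≃ₜ ↥Bᶜ`
agreeing with `β`.

Proof. `β|V : V → N` is continuous (smooth on the open set `V`) and injective with image `Bᶜ`;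
it is an open map because at every `x ∈ V` the differential is bijective, so `β` is a local
diffeomorphism at `x` (inverse function theorem on manifolds,
`Literature.Topology.FourManifolds.isLocalDiffeomorphAt_of_mfderiv`). A continuous open
injection is an open embedding, hence a homeomorphism onto its range.
-/

noncomputable section

-- the prescribed namespace `Summit.<P>.<Sub>.…` duplicates `SmoothPoincare4` (P = Sub)
set_option linter.dupNamespace false

open scoped Manifold ContDiff Topology ContinuousMap
open Set TopologicalSpace
open Literature.Topology.FourManifolds (singularHomologyZ sphereInversion IsTwistedSphere)
open Literature.Geometry.Kaehler (MForm IsSmoothForm IsClosedForm)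

namespace Summit.SmoothPoincare4.SmoothPoincare4.Theorems.OrigamiRung.PairRigidityEndgame

/-- **A smooth map with bijective differential on an open set is open there.** If `β : M → N`
(boundaryless `4`-manifolds) is `C^∞` on an open set `V` and `mfderiv β x` is bijective for
every `x ∈ V`, then `β '' W` is open for every open `W ⊆ V`: by the inverse function theorem on
manifolds `β` is a local diffeomorphism at each point of `V`. [folklore] -/
theorem isOpen_image_of_mfderiv_bijective {M : Type*} [TopologicalSpace M]
    [ChartedSpace (EuclideanSpace ℝ (Fin 4)) M] [IsManifold (𝓡 4) ∞ M] {N : Type*}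
    [TopologicalSpace N] [ChartedSpace (EuclideanSpace ℝ (Fin 4)) N] [IsManifold (𝓡 4) ∞ N]
    {V : Set M} {β : M → N} (hV : IsOpen V) (hβ : ContMDiffOn (𝓡 4) (𝓡 4) ∞ β V)
    (hbij : ∀ x ∈ V, Function.Bijective (mfderiv (𝓡 4) (𝓡 4) β x)) {W : Set M}
    (hWo : IsOpen W) (hWV : W ⊆ V) : IsOpen (β '' W) := by
  rw [isOpen_iff_forall_mem_open]
  rintro _ ⟨x, hxW, rfl⟩
  have hxV : x ∈ V := hWV hxW
  -- the differential at `x` as a continuous linear equivalence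
  let A : EuclideanSpace ℝ (Fin 4) →L[ℝ] EuclideanSpace ℝ (Fin 4) :=
    mfderiv (𝓡 4) (𝓡 4) β x
  let L : EuclideanSpace ℝ (Fin 4) ≃L[ℝ] EuclideanSpace ℝ (Fin 4) :=
    (LinearEquiv.ofBijective (A : EuclideanSpace ℝ (Fin 4) →ₗ[ℝ] EuclideanSpace ℝ (Fin 4))
      (hbij x hxV)).toContinuousLinearEquiv
  have hL : mfderiv (𝓡 4) (𝓡 4) β x
      = (L : EuclideanSpace ℝ (Fin 4) →L[ℝ] EuclideanSpace ℝ (Fin 4)) := by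
    ext v
    rfl
  -- inverse function theorem on manifolds: `β` is a local diffeomorphism at `x`
  have hloc : IsLocalDiffeomorphAt (𝓡 4) (𝓡 4) ∞ β x :=
    Literature.Topology.FourManifolds.isLocalDiffeomorphAt_of_mfderiv hV hxV hβ
      (by exact_mod_cast le_top) L hL
  obtain ⟨Φ, hxΦ, heq⟩ := hloc
  refine ⟨Φ '' (Φ.source ∩ W), ?_, ?_, ?_⟩
  · rintro _ ⟨z, ⟨hzΦ, hzW⟩, rfl⟩
    exact ⟨z, hzW, heq hzΦ⟩
  · exact Φ.toOpenPartialHomeomorph.isOpen_image_of_subset_source (Φ.open_source.inter hWo)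
      inter_subset_left
  · exact ⟨x, ⟨hxΦ, hxW⟩, (heq hxΦ).symm⟩

/-- **Stub `stub_pinch_pieceHomeomorph` — the open piece is homeomorphic to the surface
complement.** If `β : M → N` is `C^∞` and injective on the open set `V ⊆ M` with
`β '' V = Bᶜ` and bijective differential along `V`, then there is a homeomorphism
`↥V ≃ₜ ↥Bᶜ` given by `β`: the restriction `β|V` is a continuous open injection (inverse
function theorem on manifolds), i.e. an open embedding, hence a homeomorphism onto its range
`Bᶜ`. [folklore] -/
theorem stub_pinch_pieceHomeomorph : ∀ (M : Type) [TopologicalSpace M] [T2Space M] [SecondCountableTopology M] [ChartedSpace (EuclideanSpace ℝ (Fin 4)) M] [IsManifold (𝓡 4) ∞ M] (N : Type) [TopologicalSpace N] [T2Space N] [SecondCountableTopology N] [ChartedSpace (EuclideanSpace ℝ (Fin 4)) N] [IsManifold (𝓡 4) ∞ N] (V : TopologicalSpace.Opens M) (B : Set N) (β : M → N), ContMDiffOn (𝓡 4) (𝓡 4) ∞ β (V : Set M) → Set.InjOn β (V : Set M) → β '' (V : Set M) = Bᶜ → (∀ x ∈ (V : Set M), Function.Bijective (mfderiv (𝓡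 4) (𝓡 4) β x)) → ∃ e : (V : Set M) ≃ₜ (Bᶜ : Set N), ∀ x : (V : Set M), (e x : N) = β x := by
  intro M _ _ _ _ _ N _ _ _ _ _ V B β hβ hinj himg hbij
  -- the restriction `β|V : V → N` is an open embedding with range `Bᶜ`
  have hemb : Topology.IsOpenEmbedding ((V : Set M).restrict β) := by
    refine Topology.IsOpenEmbedding.of_continuous_injective_isOpenMap hβ.continuousOn.restrict
      (Set.injOn_iff_injective.1 hinj) fun U hU => ?_
    have hU' : (V : Set M).restrict β '' U = β '' (Subtype.val '' U) := by
      rw [Set.image_image]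
      rfl
    rw [hU']
    exact isOpen_image_of_mfderiv_bijective V.isOpen hβ hbij
      (V.isOpen.isOpenMap_subtype_val U hU) (Subtype.coe_image_subset _ U)
  have hrange : Set.range ((V : Set M).restrict β) = Bᶜ := by
    rw [Set.range_restrict, himg]
  exact ⟨hemb.isEmbedding.toHomeomorph.trans (Homeomorph.setCongr hrange), fun x => rfl⟩

end Summit.SmoothPoincare4.SmoothPoincare4.Theorems.OrigamiRung.PairRigidityEndgame

end
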